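import Literature.AlgebraicGeometry.Motives.MumfordTateInvariantsTensorPolarization
import Literature.AlgebraicGeometry.Motives.HodgeTensorHodgeGroupPolarizationProofs
import HarnessLib

/-!
# The Mumford–Tate group acts by similitudes of a polarization (Mumford–Tate invariants, step 18)

For a pure `ℚ`-Hodge structure `H` of weight `n` on a finite-dimensional `V` with polarization
`Q`, every `g` in the Mumford–Tate group of rational points `MT(H)(ℚ) = H.mumfordTateGroup`
(stabiliser of the weight-`0` Hodge tensors of type `(0,0)`) is a **similitude** of `Q`:
`Q(g v, g w) = ν(g) Q(v, w)` with `ν(g) ∈ ℚˣ` (`Polarization.exists_similitude_of_mem_mumfordTateGroup`).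
This is the inclusion `MT ⊆ GSp(Q)` resp. `GO(Q)` of Deligne, *Hodge cycles on abelian
varieties*, LNM 900, I (3.6, proof: "`Q` defines a morphism `V ⊗ V → ℚ(-n)` … `MT ⊆ GSp`") and
Green–Griffiths–Kerr, *Mumford–Tate groups and domains*, (I.B.6), read on `ℚ`-points.

Proof. Let `q = Σᵢⱼ Q(bᵢ, bⱼ) b^i ⊗ b^j ∈ V^{∨⊗2}` be the tensor of `Q` and
`q' = Σᵢⱼ Q^∨(b^i, b^j) bᵢ ⊗ bⱼ ∈ V^{⊗2}` the tensor of the inverse form `Q^∨`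
(`Polarization.dualForm`). The weight-`0` tensor `Ξ = q' ⊗ q ∈ T^{2,2}` is a Hodge class of type
`(0,0)` (`Polarization.xiTensor_mem_hodgeClasses`): in the tensor basis of an `h`-orthonormal
graded basis `e` of `V_ℂ`, the coordinates of `q_ℂ` are `Q_ℂ(e σ, e τ)` and those of `q'_ℂ` are
`Q^∨_ℂ(e^∨ σ, e^∨ τ)`, both zero unless `deg σ + deg τ = n`, so every occurring basis vector has
total degree `n - n = 0`. Hence `g · Ξ = Ξ` for `g ∈ MT(ℚ)`; evaluating against the functionals
`(x₀ ⊗ x₁) ⊗ (φ₀ ⊗ φ₁) ↦ φ(x₀) ψ(x₁) φ₀(v) φ₁(w)` gives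
`Q^∨(φ ∘ g, ψ ∘ g) · Q(g⁻¹ v, g⁻¹ w) = Q^∨(φ, ψ) · Q(v, w)`, whence the similitude. Consequently
`g` is a similitude of the induced form `Q_T` on every `T^{a,b}` and the `Q_T`-orthogonal of an
`MT(ℚ)`-stable subspace is `MT(ℚ)`-stable
(`Polarization.tensorSpaceAct_mem_orthogonal_of_stable`).

## References

* P. Deligne, *Hodge cycles on abelian varieties*, LNM 900 (1982), I §3, Prop. 3.6 (proof).
* M. Green, P. Griffiths, M. Kerr, *Mumford–Tate groups and domains* (2012), (I.B.6).
* D. Huybrechts, *Lectures on K3 Surfaces* (2016), proof of Thm. 3.3.9 (the pattern for `T^{0,2}`).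
-/

noncomputable section

open scoped TensorProduct
open PiTensorProduct

namespace Literature.AlgebraicGeometry.Motives

namespace HodgeStructure

universe u

variable {V : Type u} [AddCommGroup V] [Module ℚ V] [Module.Finite ℚ V] {n : ℤ}
  {H : HodgeStructure V n}

/-! ### Rank-two evaluation functionals -/

section EvalTwo

variable {K : Type*} [Field K] {M : Type*} [AddCommGroup M] [Module K M]

/-- The functional `x₀ ⊗ x₁ ↦ φ(x₀) ψ(x₁)` on `M^{⊗2}`. [folklore] -/
def evalTwo (φ ψ : Module.Dual K M) : (⨂[K]^2 M) →ₗ[K] K :=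
  PiTensorProduct.lift ((MultilinearMap.mkPiAlgebra K (Fin 2) K).compLinearMap
    fun m => (![φ, ψ] : Fin 2 → Module.Dual K M) m)

/-- `evalTwo φ ψ (⊗x) = φ (x 0) ψ (x 1)`. [folklore] -/
@[simp]
theorem evalTwo_tprod (φ ψ : Module.Dual K M) (x : Fin 2 → M) :
    evalTwo φ ψ (tprod K x) = φ (x 0) * ψ (x 1) := by
  simp [evalTwo, MultilinearMap.mkPiAlgebra_apply, Fin.prod_univ_two]

/-- The tensor of a bilinear form against `evalTwo`:
`evalTwo φ ψ (Σᵢⱼ B(b^i, b^j) bᵢ ⊗ bⱼ) = B(φ, ψ)` for a bilinear form `B` on `M^∨`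
(coordinates in the dual basis). [folklore] -/
theorem evalTwo_sum_sum_smul_tprod {ι : Type*} [Fintype ι] [DecidableEq ι] (b : Module.Basis ι K M)
    (B : LinearMap.BilinForm K (Module.Dual K M)) (φ ψ : Module.Dual K M) (g : M →ₗ[K] M) :
    evalTwo (φ ∘ₗ g) (ψ ∘ₗ g) (∑ i, ∑ j, B (b.coord i) (b.coord j) • tprod K ![b i, b j]) =
      B (φ ∘ₗ g) (ψ ∘ₗ g) := by
  simp only [map_sum, map_smul, evalTwo_tprod, Matrix.cons_val_zero, Matrix.cons_val_one,
    smul_eq_mul, LinearMap.comp_apply]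
  conv_rhs => rw [← b.dualBasis.sum_repr (φ ∘ₗ g), ← b.dualBasis.sum_repr (ψ ∘ₗ g)]
  rw [LinearMap.map_sum₂]
  refine Finset.sum_congr rfl fun i _ => ?_
  rw [map_sum]
  refine Finset.sum_congr rfl fun j _ => ?_
  simp only [map_smul, LinearMap.smul_apply, smul_eq_mul, Module.Basis.dualBasis_repr,
    LinearMap.comp_apply, Module.Basis.coe_dualBasis]
  ring

/-- The tensor of a bilinear form `B` on `M` against `evalTwo` of evaluations:
`evalTwo (ev v) (ev w) (Σᵢⱼ B(bᵢ, bⱼ) (b^i ∘ g) ⊗ (b^j ∘ g)) = B(g v, g w)`. [folklore] -/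
theorem evalTwo_eval_sum_sum_smul_tprod {ι : Type*} [Fintype ι] (b : Module.Basis ι K M)
    (B : LinearMap.BilinForm K M) (v w : M) (g : M →ₗ[K] M) :
    evalTwo (Module.Dual.eval K M v) (Module.Dual.eval K M w)
        (∑ i, ∑ j, B (b i) (b j) • tprod K ![b.coord i ∘ₗ g, b.coord j ∘ₗ g]) = B (g v) (g w) := by
  simp only [map_sum, map_smul, evalTwo_tprod, Matrix.cons_val_zero, Matrix.cons_val_one,
    smul_eq_mul, Module.Dual.eval_apply, LinearMap.comp_apply, Module.Basis.coord_apply]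
  conv_rhs => rw [← b.sum_repr (g v), ← b.sum_repr (g w)]
  rw [bilin_apply_sum_smul_sum_smul]
  refine Finset.sum_congr rfl fun i _ => Finset.sum_congr rfl fun j _ => ?_
  ring

end EvalTwo

/-! ### The tensors `q`, `q'` and `Ξ = q' ⊗ q` -/

/-- The tensor `q = Σᵢⱼ Q(bᵢ, bⱼ) b^i ⊗ b^j ∈ V^{∨⊗2}` of the polarization (`b` the standard
finite basis). [folklore] -/
def Polarization.formTensor (Q : Polarization H) : ⨂[ℚ]^2 (Module.Dual ℚ V) :=
  ∑ i, ∑ j, Q.form (Module.finBasis ℚ V i) (Module.finBasis ℚ V j) •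
    tprod ℚ ![(Module.finBasis ℚ V).coord i, (Module.finBasis ℚ V).coord j]

/-- The tensor `q' = Σᵢⱼ Q^∨(b^i, b^j) bᵢ ⊗ bⱼ ∈ V^{⊗2}` of the inverse form. [folklore] -/
def Polarization.dualFormTensor (Q : Polarization H) : ⨂[ℚ]^2 V :=
  ∑ i, ∑ j, Q.dualForm ((Module.finBasis ℚ V).coord i) ((Module.finBasis ℚ V).coord j) •
    tprod ℚ ![Module.finBasis ℚ V i, Module.finBasis ℚ V j]

/-- The weight-`0` tensor `Ξ = q' ⊗ q ∈ T^{2,2} V`. [folklore] -/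
def Polarization.xiTensor (Q : Polarization H) : hodgeTensorSpace V 2 2 :=
  Q.dualFormTensor ⊗ₜ[ℚ] Q.formTensor

/-- The action of `g` on `Ξ`, evaluated: for all `φ, ψ ∈ V^∨` and `v, w ∈ V`,
`⟨(evalTwo φ ψ) ⊗ (evalTwo (ev v) (ev w)), g · Ξ⟩ = Q^∨(φ ∘ g, ψ ∘ g) · Q(g⁻¹ v, g⁻¹ w)`.
[folklore] -/
theorem Polarization.eval_tensorSpaceAct_xiTensor (Q : Polarization H) (g : V ≃ₗ[ℚ] V)
    (φ ψ : Module.Dual ℚ V) (v w : V) :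
    (LinearMap.mul' ℚ ℚ ∘ₗ TensorProduct.map (evalTwo φ ψ)
        (evalTwo (Module.Dual.eval ℚ V v) (Module.Dual.eval ℚ V w))) (tensorSpaceAct g Q.xiTensor) =
      Q.dualForm (φ ∘ₗ (g : V →ₗ[ℚ] V)) (ψ ∘ₗ (g : V →ₗ[ℚ] V)) *
        Q.form (g.symm v) (g.symm w) := by
  classical
  rw [Polarization.xiTensor, tensorSpaceAct, TensorProduct.congr_tmul, LinearMap.comp_apply,
    TensorProduct.map_tmul, LinearMap.mul'_apply]
  congr 1
  · rw [Polarization.dualFormTensor]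
    simp only [map_sum, map_smul, PiTensorProduct.congr_tprod]
    have hvec : ∀ i j : Fin (Module.finrank ℚ V),
        (fun k => g ((![Module.finBasis ℚ V i, Module.finBasis ℚ V j] : Fin 2 → V) k)) =
          ![g (Module.finBasis ℚ V i), g (Module.finBasis ℚ V j)] := fun i j => by
      funext k; fin_cases k <;> rfl
    have h := evalTwo_sum_sum_smul_tprod (Module.finBasis ℚ V) Q.dualForm φ ψ (g : V →ₗ[ℚ] V)
    simp only [map_sum, map_smul] at h
    convert h using 3 with i _ j _
    rw [hvec i j, evalTwo_tprod, evalTwo_tprod]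
    simp
  · rw [Polarization.formTensor]
    simp only [map_sum, map_smul, PiTensorProduct.congr_tprod]
    have hvec : ∀ i j : Fin (Module.finrank ℚ V),
        (fun k => g.symm.dualMap
          ((![(Module.finBasis ℚ V).coord i, (Module.finBasis ℚ V).coord j] :
            Fin 2 → Module.Dual ℚ V) k)) =
          ![(Module.finBasis ℚ V).coord i ∘ₗ (g.symm : V →ₗ[ℚ] V),
            (Module.finBasis ℚ V).coord j ∘ₗ (g.symm : V →ₗ[ℚ] V)] := fun i j => by
      funext k; fin_cases k <;> rfl
    have h := evalTwo_eval_sum_sum_smul_tprod (Module.finBasis ℚ V) Q.form v w (g.symm : V →ₗ[ℚ] V)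
    simp only [map_sum, map_smul, LinearEquiv.coe_coe] at h
    rw [← h]
    refine Finset.sum_congr rfl fun i _ => Finset.sum_congr rfl fun j _ => ?_
    rw [hvec i j]

/-- The case `g = 1`: `⟨…, Ξ⟩ = Q^∨(φ, ψ) · Q(v, w)`. [folklore] -/
theorem Polarization.eval_xiTensor (Q : Polarization H) (φ ψ : Module.Dual ℚ V) (v w : V) :
    (LinearMap.mul' ℚ ℚ ∘ₗ TensorProduct.map (evalTwo φ ψ)
        (evalTwo (Module.Dual.eval ℚ V v) (Module.Dual.eval ℚ V w))) Q.xiTensor =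
      Q.dualForm φ ψ * Q.form v w := by
  have h := Q.eval_tensorSpaceAct_xiTensor 1 φ ψ v w
  have h1 : ∀ x : V, (1 : V ≃ₗ[ℚ] V).symm x = x := fun x => rfl
  have h2 : ((1 : V ≃ₗ[ℚ] V) : V →ₗ[ℚ] V) = LinearMap.id := rfl
  rw [tensorSpaceAct_one, h1, h1, h2, LinearMap.comp_id, LinearMap.comp_id] at h
  exact h

end HodgeStructure

end Literature.AlgebraicGeometry.Motives

end
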